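import Literature.AlgebraicGeometry.HodgeTheory.AtiyahClass
import Mathlib.Topology.Sheaves.Abelian
import HarnessLib

/-!
# Exactness of a short complex of `𝒪_X`-modules is local on sections

For a scheme `X` and a short complex `S : F₁ → F₂ → F₃` of `𝒪_X`-modules (`X.Modules`), `S` is
exact as soon as every section of `F₂` killed by `g` is LOCALLY (on `X`) in the image of `f`
(`Scheme.Modules.exact_of_locally_exact`) — the easy direction of "exactness of sheaves is stalk-
local" (Hartshorne II.1, Ex. 1.2 (c): a sequence of sheaves is exact iff it is exact on stalks;
here: forget to abelian sheaves along the faithful exact functor `Mod(𝒪_X) → Ab(X)`, then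
Mathlib's `TopCat.Sheaf.exact_iff_stalkFunctor_map_exact` and germs). Monomorphisms and
epimorphisms are tested sectionwise by the tree's `HodgeTheory.mono_of_injective_app` /
`epi_of_surjective_app`; this is the missing middle-exactness test (used for the exactness of the
Čech resolution of an `𝒪_X`-module, whose complexes of sections are exact only locally).

## References

* R. Hartshorne, *Algebraic Geometry*, GTM 52 (1977), II.1, Ex. 1.2. [Hartshorne1977]
-/

noncomputable section

universe u

open CategoryTheory CategoryTheory.Limits AlgebraicGeometry Opposite TopologicalSpace

namespace Literature.AlgebraicGeometry.Modules

open Literature.AlgebraicGeometry.HodgeTheory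

variable {X : Scheme.{u}}

/-- **Local exactness criterion for abelian sheaves on a space**: if every section of `F₂` killed
by `g` is, locally around each point, the image of a section of `F₁`, then `F₁ → F₂ → F₃` is exact
in `Ab(X)` (check on stalks). [cite: Hartshorne1977, II Ex. 1.2 (c)] -/
theorem sheaf_exact_of_locally_exact {Y : TopCat.{u}} (S : ShortComplex (TopCat.Sheaf Ab.{u} Y))
    (h : ∀ (V : Opens Y) (s : (S.X₂.obj.obj (op V) : Type u)), S.g.hom.app (op V) s = 0 →
      ∀ y ∈ V, ∃ (W : Opens Y) (i : W ⟶ V), y ∈ W ∧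
        ∃ t : (S.X₁.obj.obj (op W) : Type u), S.f.hom.app (op W) t = S.X₂.obj.map i.op s) :
    S.Exact := by
  refine (TopCat.Sheaf.exact_iff_stalkFunctor_map_exact S).mpr fun y => ?_
  rw [ShortComplex.ab_exact_iff]
  intro ξ hξ
  change (TopCat.Presheaf.stalkFunctor Ab y).obj S.X₂.obj at ξ
  change (TopCat.Presheaf.stalkFunctor Ab y).map S.g.hom ξ = 0 at hξ
  obtain ⟨V, hyV, s, rfl⟩ := TopCat.Presheaf.exists_germ_eq S.X₂.obj ξ
  rw [TopCat.Presheaf.stalkFunctor_map_germ_apply] at hξ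
  -- `g s` has zero germ, hence vanishes on some `V' ∋ y`
  have h0 : TopCat.Presheaf.germ S.X₃.obj V y hyV (S.g.hom.app (op V) s) =
      TopCat.Presheaf.germ S.X₃.obj V y hyV 0 := by
    rw [hξ, map_zero]; rfl
  obtain ⟨V', hyV', iU, iV, hres⟩ := TopCat.Presheaf.germ_eq S.X₃.obj y hyV hyV _ _ h0
  rw [map_zero] at hres
  have hgs : S.g.hom.app (op V') (S.X₂.obj.map iU.op s) = 0 := by
    rw [← hres, ← CategoryTheory.comp_apply, ← CategoryTheory.comp_apply, S.g.hom.naturality]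
  obtain ⟨W, i, hyW, t, ht⟩ := h V' (S.X₂.obj.map iU.op s) hgs y hyV'
  refine ⟨TopCat.Presheaf.germ S.X₁.obj W y hyW t, ?_⟩
  change (TopCat.Presheaf.stalkFunctor Ab y).map S.f.hom (TopCat.Presheaf.germ S.X₁.obj W y hyW t) = _
  rw [TopCat.Presheaf.stalkFunctor_map_germ_apply, ht, ← Functor.map_comp_apply, ← op_comp,
    TopCat.Presheaf.germ_res_apply]

/-- **Local exactness criterion for `𝒪_X`-modules**: if every section `s ∈ Γ(F₂, V)` with
`g(s) = 0` is, locally around each point of `V`, of the form `f(t)`, then `F₁ → F₂ → F₃` is exact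
in `X.Modules` (reflect along the faithful exact forgetful functor to abelian sheaves).
[cite: Hartshorne1977, II Ex. 1.2 (c)] -/
theorem exact_of_locally_exact (S : ShortComplex X.Modules)
    (h : ∀ (V : X.Opens) (s : Γ(S.X₂, V)), S.g.app V s = 0 →
      ∀ x ∈ V, ∃ (W : X.Opens) (i : W ⟶ V), x ∈ W ∧
        ∃ t : Γ(S.X₁, W), S.f.app W t = S.X₂.presheaf.map i.op s) :
    S.Exact := by
  rw [← ShortComplex.exact_map_iff_of_faithful S (modulesToSheaf X)]
  exact sheaf_exact_of_locally_exact _ h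

end Literature.AlgebraicGeometry.Modules

end
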